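import Summits.ResolutionOfSingularities.ResolutionOfSingularities.Theorems.FrobeniusLadderFRationalResolutionConeCertificateModel
import HarnessLib

/-!
# Crux `FrobeniusLadder.FRationalResolution` (stmt-ResolutionOfSingularities-15317), line `redirect`,
# stub `stub_diagonalizableQuotientResolution` — THE MODEL CERTIFICATE FROM CONE DATA, CARRYING THE POINT EQUATION: the exact TAIL of the
# per-point package of `…MonoidAlgebraModel.hasResolution_of_isolated_fixedPoints_of_monoidAlgebra_certificate`

`…ConeCertificateModel.modelCertificate_of_cone` (p843632) packages the model-side slots `(b, xv, hxv, y, hyJ, N, hred, hcert)`. The consumer's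
per-point existential continues, after the weight-kernel data `(G, _, _, _)`, with EXACTLY these slots followed by `φ 𝔮 = t ∧ ∀ j, certⱼ`.
Destructuring such packages with `obtain`/`match` at the residue field `κ(𝔮)` hits the `whnf` heartbeat limit (recorded in
MEMO-15317-leafhand2-g25), so here the package is produced WITH an arbitrary proposition `R` (in the application `R := (φ 𝔮 = t)`) in the
consumer's position: a class-prover closes the per-point goal by ONE anonymous constructor
`⟨k', …, G, hGfin, hG0, hGP, modelCertificate_of_cone_and κ(𝔮) P … (φ 𝔮 = t) hφt⟩` — no destructuring.

* ★★★ `modelCertificate_of_cone_and`.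

Honest label: assembly toward ONE leaf stub (no stub, crux or summit closed). No definitions, no named facts, no sorry.
[folklore; cite: CoxLittleSchenck2011, §1.1, §3.3] [cite: Kato1994, Thm. (3.2)]
-/

noncomputable section

-- single-problem summit: the doubled namespace component is forced
set_option linter.dupNamespace false

open AlgebraicGeometry IsLocalRing
open Literature.AlgebraicGeometry.Resolution

namespace Summit.ResolutionOfSingularities.ResolutionOfSingularities.Theorems.FRationalResolution.MonoidAlgebraLaurent

variable (κ : Type) [Field κ] {n : ℕ} (P : AddSubmonoid (Fin n →₀ ℕ))

/-- The exponent of `p ∈ ℕⁿ` in `ℤⁿ`. -/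
local notation3 (prettyPrint := false) "toZ" =>
  (Finsupp.mapRange.addMonoidHom (Nat.castAddMonoidHom ℤ) : (Fin n →₀ ℕ) →+ (Fin n →₀ ℤ))

/-- The vertex ideal of the monoid algebra `κ[P]`. -/
local notation3 (prettyPrint := false) "𝕍[" κ ", " P "]" =>
  Ideal.span ((fun p : ↥P => AddMonoidAlgebra.single p (1 : κ)) '' {p : ↥P | p ≠ 0})

/-- ★★★ **THE MODEL CERTIFICATE FROM CONE DATA, in the consumer's tail shape `…, R ∧ ∀ j, certⱼ`.** As
`modelCertificate_of_cone`, carrying an arbitrary proposition `R` (the point equation `φ 𝔮 = t` in the application).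
[folklore; cite: CoxLittleSchenck2011, §1.1, §3.3] -/
theorem modelCertificate_of_cone_and
    (G : Set (Fin n →₀ ℕ)) (hG0 : (0 : Fin n →₀ ℕ) ∉ G) (hGP : AddSubmonoid.closure G = P)
    {N : ℕ} (gen : Fin N → ↥P) (hgenG : ∀ i, ((gen i : ↥P) : Fin n →₀ ℕ) ∈ G) (hGgen : ∀ g ∈ G, ∃ i, ((gen i : ↥P) : Fin n →₀ ℕ) = g)
    {m : ℕ} (v : Fin m → ↥P) (hv0 : ∀ j, v j ≠ 0)
    (kk : ℕ) (hkk : 1 ≤ kk) (c : Fin N → Fin m) (jj : Fin N → ℕ) (hjj : ∀ i, jj i + 1 ≤ kk)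
    (q : ∀ i, Fin (jj i) → ↥P) (hq0 : ∀ i l, q i l ≠ 0) (hid : ∀ i, (jj i + 1) • gen i = v (c i) + ∑ l, q i l)
    (hcone : ∀ j : Fin m, ∃ (n' : ℕ) (Q : AddSubmonoid (Fin n' →₀ ℕ)) (ι : ↥Q →+ (Fin n →₀ ℤ)) (_ : Function.Injective ι)
      (_ : ∀ e : ↥P, e ≠ 0 → ∃ u : ↥Q, ι u = toZ (e : Fin n →₀ ℕ) - toZ ((v j : ↥P) : Fin n →₀ ℕ))
      (_ : ∀ p : ↥P, ∃ u : ↥Q, ι u = toZ (p : Fin n →₀ ℕ))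
      (_ : ∀ u : ↥Q, ∃ (p : ↥P) (r : ℕ) (e : Fin r → ↥P), (∀ i, e i ≠ 0) ∧
        ι u = toZ (p : Fin n →₀ ℕ) + ∑ i, (toZ ((e i : ↥P) : Fin n →₀ ℕ) - toZ ((v j : ↥P) : Fin n →₀ ℕ)))
      (GQ : Set (Fin n' →₀ ℕ)) (_ : GQ.Finite) (_ : (0 : Fin n' →₀ ℕ) ∉ GQ) (_ : AddSubmonoid.closure GQ = Q),
      (∀ u : ↥Q, (u : Fin n' →₀ ℕ) ∈ GQ → IsRegularRing (Localization.Away (AddMonoidAlgebra.single u (1 : κ)))) ∧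
      (∀ (K : Type) [Field K], Scheme.IsRegular (affineBlowup (Ideal.span {w : ↥(Algebra.adjoin K
        ((fun d : Fin n' →₀ ℕ => MvPolynomial.monomial d (1 : K)) '' GQ)) |
        ∃ d ∈ GQ, (w : MvPolynomial (Fin n') K) = MvPolynomial.monomial d 1}))))
    (R : Prop) (hR : R) :
    ∃ (b nx : ℕ) (xv : Fin nx → AddMonoidAlgebra κ ↥P) (_ : 𝕍[κ, P] ^ (b + 1) = Ideal.span (Set.range xv))
      (m' : ℕ) (y : Fin m' → AddMonoidAlgebra κ ↥P) (_ : ∀ j, y j ∈ 𝕍[κ, P] ^ (b + 1)) (N' : ℕ)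
      (_ : (𝕍[κ, P] ^ (b + 1)) ^ (N' + 1) ≤ Ideal.span (Set.range y) * (𝕍[κ, P] ^ (b + 1)) ^ N'),
      R ∧ ∀ j : Fin m', ∃ (G' : Set (blowupAlgebra (𝕍[κ, P] ^ (b + 1)) (y j))) (𝔪 : Ideal (blowupAlgebra (𝕍[κ, P] ^ (b + 1)) (y j)))
        (_ : 𝔪.IsMaximal) (M : ℕ),
        (∀ g ∈ G', IsRegularRing (Localization.Away g)) ∧
        𝔪 ^ M ≤ (𝕍[κ, P]).map (algebraMap _ (blowupAlgebra (𝕍[κ, P] ^ (b + 1)) (y j))) ⊔ Ideal.span G' ∧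
        (¬ IsRegularLocalRing (Localization.AtPrime 𝔪) →
          Scheme.IsRegular (affineBlowup (R := Localization.AtPrime 𝔪) (maximalIdeal (Localization.AtPrime 𝔪)))) := by
  obtain ⟨b, nx, xv, hxv, m', y, hyJ, N', hred, hcert⟩ :=
    modelCertificate_of_cone κ P G hG0 hGP gen hgenG hGgen v hv0 kk hkk c jj hjj q hq0 hid hcone
  exact ⟨b, nx, xv, hxv, m', y, hyJ, N', hred, hR, hcert⟩

end Summit.ResolutionOfSingularities.ResolutionOfSingularities.Theorems.FRationalResolution.MonoidAlgebraLaurent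

end
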